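import Literature.MathematicalPhysics.QuantumLattice.InfiniteVolumeLSMBondProofs
import HarnessLib

/-!
# The local twist of a half-odd-integer spin chain: block rotation, block magnetisation, and
# Koma's inequality

Trunk **T-QLATTICE**, family `hubbard`, statement **hubbard.S23**. Definitions-and-proofs file behind
the named facts `not_hasUniqueGappedGroundState_halfOddSpin` and
`no_unique_gapped_groundState_halfOddSpin` of `InfiniteVolume.lean` (Affleck–Lieb 1986; Tasaki 2022,
Cor. 3.6). On top of the diagonal twist `twistOp θ = exp[-i Σ_x θ_x (Ŝᶻ_x + S)]` of
`SpinFlipTwist.lean` it introduces the concrete objects of the local-twist argument on the chain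
`ℤ = Site 1` and proves their two structural properties:

* the interval regions `Ival a b = {a, …, b}`, the **twist angle**
  `θ_z = (2π/ℓ)·clamp(z, 0, ℓ)` (`twistAngle`; Tasaki 2022, eq. (3.2) with `x = 0`), the block
  rotation angle `(2π/ℓ)[1 ≤ z ≤ ℓ] = θ_z - θ_{z-1}` (`blockAngle`) and the block indicator
  (`blockWeight`, `blockInd`);
* the **local twist** `U = U_θ` on a region (`localTwistOp`; Tasaki 2022, eq. (3.3), `Û_{0,ℓ}`),
  its translate `U⁺ = U_{θ(·-1)}` (`localTwistOpShift`; `𝒯_1(Û)`, eq. (3.15)), the **uniform block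
  rotation** `R = exp[-i(2π/ℓ) Σ_{z=1}^{ℓ}(Ŝᶻ_z + S)]` (`blockRot`) with **`U = R U⁺`**
  (`localTwistOp_eq_blockRot_mul_localTwistOpShift`; Tasaki 2022, eq. (3.16),
  `Û_{x,ℓ} = e^{i2πx ν̂_ℓ} Û_{0,ℓ}`; Tasaki 2018, proof of Lemma 2, `T̂†ÛT̂ = exp[2πiρ̂_ℓ]Û`), and the
  **block magnetisation** `M = Σ_{z=1}^{ℓ} Sᶻ_z` (`blockMag`);
* **Koma's inequality in operator form** (`posSemidef_blockMag_sq_sub`; Tasaki 2018, Lemma 2 and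
  its proof, eqs. (3.7)–(3.11); Tasaki 2022, eq. (3.17)): for odd `n = 2S`, `ℓ ≠ 0` and a region
  containing the block, the diagonal operator `(2π/ℓ)² M² - (2·1 + R + Rᴴ)` is positive
  semidefinite — entrywise `R = e^{-i((2π/ℓ)m + πn)}` where `m = ⟨σ|M|σ⟩` (the block has `ℓ`
  sites), so `2 + R + Rᴴ = 2 - 2cos((2π/ℓ)m) = 4 sin²(πm/ℓ) ≤ (2π/ℓ)² m²`: the half-odd-integer
  filling `ν = S`, `e^{2πiν} = -1`, is exactly where `Odd n` enters.

No statement of any other file is changed. The assembly of the Affleck–Lieb theorem from these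
objects is `InfiniteVolumeHalfOddSpinProofs.lean`.

## References

* H. Tasaki, *The Lieb–Schultz–Mattis theorem: a topological point of view*, in: The Physics and
  Mathematics of Elliott Lieb, vol. 2, EMS Press (2022) 405–446, arXiv:2202.06243 (held), §3.1
  eqs. (3.2)–(3.3), §3.2 proof of Lemma 3.3, eqs. (3.15)–(3.17). [Tasaki2022]
* H. Tasaki, *Lieb–Schultz–Mattis theorem with a local twist for general one-dimensional quantum
  systems*, J. Stat. Phys. 170 (2018) 653–671, arXiv:1708.05186 (held), §3, Lemma 2 (Koma's
  inequality) and its proof. [Tasaki2018]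
* I. Affleck, E. H. Lieb, Lett. Math. Phys. 12 (1986) 57–69 (the local twist; not held).
  [AffleckLiebLMP1986]
-/

noncomputable section

open Matrix Complex Finset
open scoped ComplexOrder Matrix.Norms.L2Operator

namespace Literature.MathematicalPhysics.QuantumLattice

open Literature.Probability.LatticeModels
open Literature.Probability.LatticeModels (Site)

section Setup

variable (n : ℕ)

/-- The interval region `{a, …, b} ⊆ ℤ = Site 1` (as `Finset.Icc` for the product order on `Fin 1 → ℤ`).
[folklore] -/
def Ival (a b : ℤ) : Finset (Site 1) := Finset.Icc (fun _ => a) (fun _ => b)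

/-- Membership in `Ival a b`. [folklore] -/
theorem mem_Ival {a b : ℤ} {x : Site 1} : x ∈ Ival a b ↔ a ≤ x 0 ∧ x 0 ≤ b := by
  simp only [Ival, Finset.mem_Icc, Pi.le_def, Fin.forall_fin_one]

/-- Clamping an integer to `[0, ℓ]`. [folklore] -/
def clampI (ℓ : ℕ) (t : ℤ) : ℤ := max 0 (min t ℓ)

/-- `clamp(t) - clamp(t-1) = [1 ≤ t ≤ ℓ]`. [folklore] -/
theorem clampI_sub_clampI_pred (ℓ : ℕ) (t : ℤ) :
    clampI ℓ t - clampI ℓ (t - 1) = if 1 ≤ t ∧ t ≤ ℓ then 1 else 0 := by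
  simp only [clampI, max_def, min_def]
  split_ifs <;> omega

/-- `clamp(t) = 0` for `t ≤ 0`. [folklore] -/
theorem clampI_of_nonpos (ℓ : ℕ) {t : ℤ} (ht : t ≤ 0) : clampI ℓ t = 0 := by
  simp only [clampI, max_def, min_def]; split_ifs <;> omega

/-- `clamp(t) = ℓ` for `t ≥ ℓ`. [folklore] -/
theorem clampI_of_le (ℓ : ℕ) {t : ℤ} (ht : (ℓ : ℤ) ≤ t) : clampI ℓ t = ℓ := by
  simp only [clampI, max_def, min_def]; split_ifs <;> omega

/-- The **twist angle** `θ_z = (2π/ℓ) clamp(z, 0, ℓ)`: `0` left of the block, growing linearly from `0`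
to `2π` across `{0, …, ℓ}`, and `2π` to the right. Tasaki (2022) §3.1, eq. (3.2) (with `x = 0`);
Tasaki (2018) eq. (3.2); Affleck–Lieb (1986). [cite: Tasaki2022, §3.1 eq. (3.2)] -/
def twistAngle (ℓ : ℕ) (z : Site 1) : ℝ := 2 * Real.pi / ℓ * (clampI ℓ (z 0) : ℝ)

/-- The **block rotation angle** `(2π/ℓ)·[1 ≤ z ≤ ℓ]` (`= θ_z - θ_{z-1}`). Tasaki (2022), proof of
Lemma 3.3, eq. (3.16). [cite: Tasaki2022, §3.2 eq. (3.16)] -/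
def blockAngle (ℓ : ℕ) (z : Site 1) : ℝ := if 1 ≤ z 0 ∧ z 0 ≤ ℓ then 2 * Real.pi / ℓ else 0

/-- The **block indicator** `[1 ≤ z ≤ ℓ]` (as a complex weight). [folklore] -/
def blockWeight (ℓ : ℕ) (z : Site 1) : ℂ := if 1 ≤ z 0 ∧ z 0 ≤ ℓ then 1 else 0

/-- `θ_z - θ_{z-1} = (2π/ℓ)[1 ≤ z ≤ ℓ]`. Tasaki (2022), proof of Lemma 3.3 ("`θ_{j+p} = θ_j + 2π/ℓ` if
`1 ≤ j ≤ pℓ`", Tasaki 2018 proof of Lemma 2). [cite: Tasaki2022, §3.2 eq. (3.16)] -/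
theorem twistAngle_sub_twistAngle_sub_one (ℓ : ℕ) (z : Site 1) :
    twistAngle ℓ z - twistAngle ℓ (z - 1) = blockAngle ℓ z := by
  simp only [twistAngle, blockAngle, Pi.sub_apply, Pi.one_apply, ← mul_sub]
  have h := clampI_sub_clampI_pred ℓ (z 0)
  have h' : (clampI ℓ (z 0) : ℝ) - (clampI ℓ (z 0 - 1) : ℝ) = if 1 ≤ z 0 ∧ z 0 ≤ ℓ then 1 else 0 := by
    rw [← Int.cast_sub, h]; split_ifs <;> simp
  rw [h']
  split_ifs <;> simp

/-- `θ_z = 0` for `z ≤ 0`. Tasaki (2022) eq. (3.2). [cite: Tasaki2022, §3.1 eq. (3.2)] -/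
theorem twistAngle_of_nonpos (ℓ : ℕ) {z : Site 1} (hz : z 0 ≤ 0) : twistAngle ℓ z = 0 := by
  simp [twistAngle, clampI_of_nonpos ℓ hz]

/-- `θ_z = 2π` for `z ≥ ℓ` (`ℓ ≠ 0`). Tasaki (2022) eq. (3.2). [cite: Tasaki2022, §3.1 eq. (3.2)] -/
theorem twistAngle_of_le (ℓ : ℕ) (hℓ : ℓ ≠ 0) {z : Site 1} (hz : (ℓ : ℤ) ≤ z 0) :
    twistAngle ℓ z = 2 * Real.pi := by
  rw [twistAngle, clampI_of_le ℓ hz]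
  have : (ℓ : ℝ) ≠ 0 := by exact_mod_cast hℓ
  field_simp
  push_cast
  ring

/-- `θ_{z+1} - θ_z = (2π/ℓ)[0 ≤ z ≤ ℓ-1]`: consecutive twist angles differ by `2π/ℓ` on exactly `ℓ` bonds.
Tasaki (2022), proof of Lemma 3.1 ("the interval `I` may contain at most `ℓ+1` sites").
[cite: Tasaki2022, §3.1 eq. (3.13)] -/
theorem twistAngle_add_one_sub (ℓ : ℕ) (z : Site 1) :
    twistAngle ℓ (z + 1) - twistAngle ℓ z = if 0 ≤ z 0 ∧ z 0 ≤ (ℓ : ℤ) - 1 then 2 * Real.pi / ℓ else 0 := by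
  have h := twistAngle_sub_twistAngle_sub_one ℓ (z + 1)
  rw [add_sub_cancel_right] at h
  rw [h, blockAngle]
  simp only [Pi.add_apply, Pi.one_apply]
  by_cases h1 : 0 ≤ z 0 ∧ z 0 ≤ (ℓ : ℤ) - 1
  · rw [if_pos h1, if_pos (by omega)]
  · rw [if_neg h1, if_neg (by omega)]

end Setup

section Koma

variable (n ℓ : ℕ)

/-- The **local twist operator** `U = exp[-i Σ_{z ∈ Λ} θ_z (Ŝᶻ_z + S)]` on a region (Affleck–Lieb's
local twist; Tasaki 2022, eq. (3.3) `Û_{0,ℓ}`; Tasaki 2018, eq. (3.1)), as the diagonal twist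
`twistOp` of `SpinFlipTwist.lean` with the twist angles `θ_z = twistAngle ℓ z`.
[cite: Tasaki2022, §3.1 eq. (3.3)] -/
def localTwistOp (Λ : Finset (Site 1)) : Op ↥Λ (n + 1) :=
  twistOp fun z : ↥Λ => twistAngle ℓ z

/-- The translate of the local twist by one site, `U⁺ = exp[-i Σ_z θ_{z-1} (Ŝᶻ_z + S)]` (`= 𝒯_1(Û)`,
Tasaki 2022 eq. (3.15) with `p = 1`). [cite: Tasaki2022, §3.2 eq. (3.15)] -/
def localTwistOpShift (Λ : Finset (Site 1)) : Op ↥Λ (n + 1) :=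
  twistOp fun z : ↥Λ => twistAngle ℓ ((z : Site 1) - 1)

/-- The **uniform rotation of the block** `{1, …, ℓ}` by `2π/ℓ` about the `3`-axis,
`R = exp[-i(2π/ℓ) Σ_{z=1}^{ℓ} (Ŝᶻ_z + S)]` (`e^{i2πx ν̂_ℓ}` at `x = 1` up to sign conventions,
Tasaki 2022 eq. (3.16); `exp[2πi ρ̂_ℓ]`, Tasaki 2018 proof of Lemma 2). [cite: Tasaki2022, §3.2 eq. (3.16)] -/
def blockRot (Λ : Finset (Site 1)) : Op ↥Λ (n + 1) :=
  twistOp fun z : ↥Λ => blockAngle ℓ z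

/-- The **block magnetisation** `M = Σ_{z ∈ [1,ℓ]} Sᶻ_z` on a region (`ℓ(ν̂_ℓ - S)`, Tasaki 2022
eq. (3.16); `ℓ(ρ̂_ℓ - ν)`, Tasaki 2018 eq. (2.7)). [cite: Tasaki2022, §3.2 eq. (3.16)] -/
def blockMag (Λ : Finset (Site 1)) : Op ↥Λ (n + 1) :=
  ∑ z : ↥Λ, blockWeight ℓ z • onSite z (SpinOperators.spinZ n)

/-- Unfolding `localTwistOp`. [cite: Tasaki2022, §3.1 eq. (3.3)] -/
theorem localTwistOp_def (Λ : Finset (Site 1)) :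
    localTwistOp n ℓ Λ = twistOp fun z : ↥Λ => twistAngle ℓ z := rfl

/-- Unfolding `localTwistOpShift`. [cite: Tasaki2022, §3.2 eq. (3.15)] -/
theorem localTwistOpShift_def (Λ : Finset (Site 1)) :
    localTwistOpShift n ℓ Λ = twistOp fun z : ↥Λ => twistAngle ℓ ((z : Site 1) - 1) := rfl

/-- Unfolding `blockRot`. [cite: Tasaki2022, §3.2 eq. (3.16)] -/
theorem blockRot_def (Λ : Finset (Site 1)) :
    blockRot n ℓ Λ = twistOp fun z : ↥Λ => blockAngle ℓ z := rfl

/-- Unfolding `blockMag`. [cite: Tasaki2022, §3.2 eq. (3.16)] -/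
theorem blockMag_def (Λ : Finset (Site 1)) :
    blockMag n ℓ Λ = ∑ z : ↥Λ, blockWeight ℓ z • onSite z (SpinOperators.spinZ n) := rfl

/-- **`U = R U⁺`**: the local twist is its translate followed by the uniform block rotation
(`θ_z = (θ_z - θ_{z-1}) + θ_{z-1}` and `twistOp_add`). Tasaki (2022), proof of Lemma 3.3, eq. (3.16)
(`Û_{x,ℓ} = e^{i2πx ν̂_ℓ} Û_{0,ℓ}`); Tasaki (2018), proof of Lemma 2 (`T̂†ÛT̂ = exp[2πi ρ̂_ℓ] Û`).
[cite: Tasaki2022, §3.2 eq. (3.16)] -/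
theorem localTwistOp_eq_blockRot_mul_localTwistOpShift (Λ : Finset (Site 1)) :
    localTwistOp n ℓ Λ = blockRot n ℓ Λ * localTwistOpShift n ℓ Λ := by
  rw [localTwistOp, blockRot, localTwistOpShift, ← twistOp_add]
  congr 1
  funext z
  rw [Pi.add_apply, ← twistAngle_sub_twistAngle_sub_one]
  ring

/-- The block rotation is diagonal in the product basis,
`⟨σ|R|σ⟩ = exp(-i Σ_z φ_z (n - σ_z))`. [folklore] -/
theorem blockRot_eq_diagonal (Λ : Finset (Site 1)) :
    blockRot n ℓ Λ = diagonal fun σ : TensorIndex ↥Λ (n + 1) =>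
      Complex.exp (-(I * ((∑ z : ↥Λ, blockAngle ℓ z * (((σ z).rev : ℕ) : ℝ) : ℝ) : ℂ))) := rfl

/-- The block magnetisation is diagonal in the product basis, `⟨σ|M|σ⟩ = Σ_{z∈[1,ℓ]} (n/2 - σ_z)`. [folklore] -/
theorem blockMag_eq_diagonal (Λ : Finset (Site 1)) :
    blockMag n ℓ Λ = diagonal fun σ : TensorIndex ↥Λ (n + 1) =>
      ∑ z : ↥Λ, blockWeight ℓ z * ((n : ℂ) / 2 - ((σ z : ℕ) : ℂ)) := by
  rw [blockMag]
  have : ∀ z : ↥Λ, blockWeight ℓ z • (onSite z (SpinOperators.spinZ n) : Op ↥Λ (n + 1)) =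
      onSite z (diagonal fun j : Fin (n + 1) => blockWeight ℓ z * ((n : ℂ) / 2 - (j : ℕ))) := by
    intro z
    rw [SpinOperators.spinZ, ← onSite_smul', ← diagonal_smul]
    rfl
  simp_rw [this]
  exact sum_onSite_diagonal _ _

/-- The real block indicator `[1 ≤ z ≤ ℓ]`. [folklore] -/
def blockInd (ℓ : ℕ) (z : Site 1) : ℝ := if 1 ≤ z 0 ∧ z 0 ≤ ℓ then 1 else 0

/-- `blockWeight` is the complexified real indicator. [folklore] -/
theorem blockWeight_eq (z : Site 1) : blockWeight ℓ z = ((blockInd ℓ z : ℝ) : ℂ) := by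
  simp only [blockWeight, blockInd]; split_ifs <;> simp

/-- `blockAngle = (2π/ℓ) · blockInd`. [folklore] -/
theorem blockAngle_eq (z : Site 1) : blockAngle ℓ z = 2 * Real.pi / ℓ * blockInd ℓ z := by
  simp only [blockAngle, blockInd]; split_ifs <;> simp

/-- A region containing the block `{1, …, ℓ}` has exactly `ℓ` block sites. [folklore] -/
theorem card_block_eq (Λ : Finset (Site 1)) (hI : ∀ z : Site 1, 1 ≤ z 0 → z 0 ≤ ℓ → z ∈ Λ) :
    (univ.filter fun z : ↥Λ => 1 ≤ (z : Site 1) 0 ∧ (z : Site 1) 0 ≤ ℓ).card = ℓ := by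
  have hc : (Finset.Icc (1 : ℤ) ℓ).card = ℓ := by
    rw [Int.card_Icc]; simp
  refine Eq.trans ?_ hc
  refine Finset.card_bij' (fun z _ => (z : Site 1) 0) (fun t ht => ⟨fun _ => t, hI _ ?_ ?_⟩)
    ?_ ?_ ?_ ?_
  · exact (Finset.mem_Icc.1 ht).1
  · exact (Finset.mem_Icc.1 ht).2
  · intro z hz
    exact Finset.mem_Icc.2 (Finset.mem_filter.1 hz).2
  · intro t ht
    exact Finset.mem_filter.2 ⟨mem_univ _, (Finset.mem_Icc.1 ht)⟩
  · intro z _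
    exact Subtype.ext (funext fun i => by rw [Subsingleton.elim i 0])
  · intro t _
    rfl

/-- `Σ_{z ∈ Λ} [1 ≤ z ≤ ℓ] = ℓ` for a region containing the block (real form). [folklore] -/
theorem sum_blockInd_eq (Λ : Finset (Site 1)) (hI : ∀ z : Site 1, 1 ≤ z 0 → z 0 ≤ ℓ → z ∈ Λ) :
    ∑ z : ↥Λ, blockInd ℓ z = (ℓ : ℝ) := by
  simp only [blockInd]
  rw [Finset.sum_boole, card_block_eq ℓ Λ hI]

/-- `Σ_{z ∈ Λ} [1 ≤ z ≤ ℓ] = ℓ` for a region containing the block (complex form). [folklore] -/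
theorem sum_blockWeight_eq (Λ : Finset (Site 1)) (hI : ∀ z : Site 1, 1 ≤ z 0 → z 0 ≤ ℓ → z ∈ Λ) :
    ∑ z : ↥Λ, blockWeight ℓ z = (ℓ : ℂ) := by
  simp only [blockWeight]
  rw [Finset.sum_boole, card_block_eq ℓ Λ hI]

/-- `e^{-it} + conj(e^{-it}) = 2 cos t` for real `t`. [folklore] -/
theorem cexp_neg_I_mul_add_star (t : ℝ) :
    Complex.exp (-(I * t)) + star (Complex.exp (-(I * t))) = ((2 * Real.cos t : ℝ) : ℂ) := by
  rw [Complex.star_def, ← Complex.exp_conj, map_neg, map_mul, Complex.conj_I, Complex.conj_ofReal,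
    Complex.ofReal_mul, Complex.ofReal_ofNat, Complex.ofReal_cos, Complex.two_cos, add_comm]
  congr 1 <;> ring_nf

/-- **Koma's inequality, operator form** (Tasaki 2018, Lemma 2, eq. (3.7) and its proof, eq. (3.11);
Tasaki 2022, eq. (3.17)): for odd `n = 2S` (half-odd-integer spin), `ℓ ≠ 0` and a region containing
the block, the diagonal operator `(2π/ℓ)² M² - (2·1 + R + Rᴴ)` is positive semidefinite, where `M` is
the block magnetisation and `R` the uniform block rotation. Entrywise `⟨σ|R|σ⟩ = e^{i(πn - (2π/ℓ)m)}`
with `m = ⟨σ|M|σ⟩` (the block has `ℓ` sites), so `2 + R + Rᴴ = 2 - 2cos((2π/ℓ)m) = 4 sin²(πm/ℓ)`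
(`n` odd: the filling `ν = S` is a half-odd-integer, `e^{2πiν} = -1`) and `4 sin² t ≤ 4t²`.
[cite: Tasaki2018, §3 Lemma 2] -/
theorem posSemidef_blockMag_sq_sub {n ℓ : ℕ} (hn : Odd n) (hℓ : ℓ ≠ 0) (Λ : Finset (Site 1))
    (hI : ∀ z : Site 1, 1 ≤ z 0 → z 0 ≤ ℓ → z ∈ Λ) :
    ((((2 * Real.pi / ℓ) ^ 2 : ℝ) : ℂ) • (blockMag n ℓ Λ * blockMag n ℓ Λ) -
      ((2 : ℂ) • 1 + blockRot n ℓ Λ + (blockRot n ℓ Λ)ᴴ)).PosSemidef := by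
  set a : ℝ := 2 * Real.pi / ℓ with ha
  have haℓ : a * ℓ = 2 * Real.pi := by
    rw [ha]; field_simp
  rw [blockMag_eq_diagonal, blockRot_eq_diagonal, diagonal_mul_diagonal, diagonal_conjTranspose,
    ← diagonal_smul, Matrix.smul_one_eq_diagonal, diagonal_add, diagonal_add, diagonal_sub]
  refine PosSemidef.diagonal fun σ => ?_
  -- the real quantities behind the entries
  set μ : ℝ := ∑ z : ↥Λ, blockInd ℓ z * ((n : ℝ) / 2 - (σ z : ℕ)) with hμ
  set N : ℝ := ∑ z : ↥Λ, blockInd ℓ z * (((σ z).rev : ℕ) : ℝ) with hN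
  have hm : (∑ z : ↥Λ, blockWeight ℓ z * ((n : ℂ) / 2 - ((σ z : ℕ) : ℂ))) = (μ : ℂ) := by
    rw [hμ]; push_cast; simp only [blockWeight_eq]
  have he : (∑ z : ↥Λ, blockAngle ℓ z * (((σ z).rev : ℕ) : ℝ)) = a * N := by
    rw [hN, Finset.mul_sum]
    refine Finset.sum_congr rfl fun z _ => ?_
    rw [blockAngle_eq, ha]; ring
  have hNμ : a * N = a * μ + n * Real.pi := by
    have : N - μ = (n : ℝ) / 2 * ℓ := by
      rw [hN, hμ, ← Finset.sum_sub_distrib, ← sum_blockInd_eq ℓ Λ hI, Finset.mul_sum]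
      refine Finset.sum_congr rfl fun z _ => ?_
      rw [natCast_val_rev_real]; ring
    have h2 : a * N - a * μ = n * Real.pi := by
      rw [← mul_sub, this, show a * ((n : ℝ) / 2 * ℓ) = (a * ℓ) * n / 2 by ring, haℓ]; ring
    linarith
  simp only [Pi.smul_apply, Pi.star_apply, smul_eq_mul]
  rw [hm, he, add_assoc, cexp_neg_I_mul_add_star, hNμ, Real.cos_add_nat_mul_pi, hn.neg_one_pow]
  -- now a real inequality
  have key : (0 : ℝ) ≤ a ^ 2 * (μ * μ) - (2 + 2 * (-1 * Real.cos (a * μ))) := by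
    have := Real.one_sub_sq_div_two_le_cos (x := a * μ)
    nlinarith
  have : ((a ^ 2 : ℝ) : ℂ) * ((μ : ℂ) * (μ : ℂ)) - (2 + ((2 * (-1 * Real.cos (a * μ)) : ℝ) : ℂ)) =
      ((a ^ 2 * (μ * μ) - (2 + 2 * (-1 * Real.cos (a * μ))) : ℝ) : ℂ) := by
    push_cast; ring
  rw [this]
  exact Complex.zero_le_real.2 key

end Koma

end Literature.MathematicalPhysics.QuantumLattice
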